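import Literature.NumberTheory.Automorphic.UnitaryFormGroupSemiregularProper   -- ★ p850134 FILE D1 (this seat): `uniformlyProper_of_marker`, `stabilizer_le_centralizer_of_coe_eq`
import Literature.NumberTheory.Automorphic.ArchLocalTorusOrbitalCompactWall      -- ★ p839953 (F0P3a-p06 (g10)): `list_prod_map_units_conj`, `diagonal_sub_smul_one`, `list_prod_map_diagonal_sub_smul_one` (the SAME Lagrange block polynomial, there for COMPACT walls)
import Literature.LinearAlgebra.Matrix.SesquilinearFormDeterminesMatrix          -- ★ `star_single_dotProduct_mulVec_single` (`eᵢᴴ A eⱼ = A i j`)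
import HarnessLib

/-!
# Harish-Chandra's compactness lemma at a semi-regular point — the DIAGONAL chart: the Lagrange eigenprojector marker
# (Rogawski 1990 §4.12 Lemma 4.12.1, §8.2; Harish-Chandra–van Dijk 1970 Part I §3 Lemma 22; Varadarajan 1977 Part II §2; Knapp 1986 V §3)

Topic `NumberTheory/Automorphic`; namespace `Literature.NumberTheory.Automorphic.UnitaryGroup`.  THEOREMS ONLY (no `def`, no instance, no notation, no axiom, no named fact, no
`sorry`).  Cell `pub/hodgecm-mathlib`, crux H413 (`stmt-HodgeConjecture-24833`), F0∕P3c line LH3 (closer stub `stub_N9`, organ J), brick **(J-DESC) FILE D1b** (seat F0P3a-p08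
(g22)): the marker hypothesis of ★ `uniformlyProper_of_marker` DISCHARGED for a chart of DIAGONAL elements `c(x) = diag(d(x))` of `U(J)(ℂ)` (the house frame of the inner form
`G′_w = U(diag a)(ℂ)`: ★ `gprimeCptGL`, compact Cartan = unit diagonals) at a coordinate line `k` on which the form is diagonal (`J k j = 0` for `j ≠ k`, `J k k ≠ 0`) and whose
eigenvalue `d(x)_k` is SIMPLE on `S` (`d(x)_k ≠ d(x)_j`, `j ≠ k` — the OTHER eigenvalues may collide on `S`, e.g. at the Cayley wall `θ₀ = θ₂` of ★ `gprimeTorus_of_wall`).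

THE MARKER (`n = Fin N`).  `F x m := Δ(x)⁻¹ · ∏_{j ≠ k} (m − d(x)_j · 1)`, `Δ(x) = ∏_{j ≠ k} (d(x)_k − d(x)_j) ≠ 0` on `S` (a `List.prod` over `(univ.erase k).toList`, so no
commutativity is invoked) — the block polynomial `Q_I` of ★ `ArchLocalTorusOrbitalCompactWall` (F0P3a-p06 (g10)) at the singleton block `I = {k}`; that file proves joint
properness IN THE GROUP across COMPACT walls and records «noncompact walls: properness FAILS there» — here the same marker gives properness MODULO `M = Z(s)` across the
NONCOMPACT walls, which is what the descent needs.  `F` is jointly continuous on `S × M_N(ℂ)` (§1), conjugation-equivariant (★ `list_prod_map_units_conj`, §1), and at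
`m = diag(d(x))` equals `Δ⁻¹ · diag(∏_{j≠k}(dᵢ − dⱼ))ᵢ = E_kk = E_e` for `e = e_k` (★ `list_prod_map_diagonal_sub_smul_one`; §2: the `i`-th diagonal entry has the vanishing
factor `j = i` unless `i = k`).  Hence (§3):
* **`uniformlyProper_diagonal_of_ne`** — the (HYP) of ★ `continuousOn_integral_descConj_of_uniformlyProper` for the diagonal chart on `S` MODULO any `M ≥ Stab(e_k)`;
* **`exists_isCompact_mul_diagonal_of_ne`** — the group-level «`y ∈ C′·M`» form (the `hCM` binder of ★ `orbitalIntegral_eq_orbitalIntegral_descended`, uniform in `x ∈ K`);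
* `stabilizer_single_le_centralizer_of_diagonal` — `Stab(e_k) ≤ Z(s)` for every diagonal `s` that is SCALAR off the line `k` (the semi-regular points), so `M := Z(s)` is admissible.
HONEST LABEL: HC_CM is proved only modulo the 7 printed citations (2 remaining named inputs: hLiu418 = `stmt-HodgeConjecture-24832`, h413 = `stmt-HodgeConjecture-24833`) until rung 0
closes; count-neutral topology under organ J of `stub_N9`.

## References
* [Rogawski1990] J. D. Rogawski, *Automorphic Representations of Unitary Groups in Three Variables*, Ann. of Math. Stud. 123 (1990), §4.12 Lemma 4.12.1 p. 66, §8.2 p. 114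
  (the compactness lemma and the descended function), §3.6 p. 31.
* [HarishChandra1970] Harish-Chandra (notes by G. van Dijk), *Harmonic Analysis on Reductive p-adic Groups*, LNM 162 (1970), Part I §3 Lemma 22.
* [Varadarajan1977] V. S. Varadarajan, *Harmonic Analysis on Real Reductive Groups*, LNM 576 (1977), Part II §2.
* [Knapp1986] A. W. Knapp, *Representation Theory of Semisimple Groups* (1986), Ch. V §3 (Cartan subgroups of `SU(2,1)`).
* [HornJohnson2013] R. A. Horn, C. R. Johnson, *Matrix Analysis*, 2nd ed. (2013), Thm. 1.3.9, §0.9.1 (spectral projectors as polynomials in the matrix; diagonal calculus).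
-/

set_option autoImplicit false

noncomputable section

open Matrix MulAction Topology Set
open scoped MatrixGroups ComplexConjugate Pointwise

namespace Literature.NumberTheory.Automorphic.UnitaryGroup

/-! ## §1 The Lagrange product `∏ⱼ (m − μⱼ·1)`: conjugation-equivariance (★ `list_prod_map_units_conj`) and joint continuity -/

section Lagrange

variable {N : ℕ}

/-- Conjugation by `g ∈ GL_N(ℂ)` passes through `m − μ·1`. [cite: HornJohnson2013, §1.3 (Obs. 1.3.1)] -/
private theorem units_conj_sub_smul_one (g : GL (Fin N) ℂ) (m : Matrix (Fin N) (Fin N) ℂ) (μ : ℂ) :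
    (g : Matrix (Fin N) (Fin N) ℂ) * (m - μ • (1 : Matrix (Fin N) (Fin N) ℂ)) * ((g⁻¹ : GL (Fin N) ℂ) : Matrix (Fin N) (Fin N) ℂ) =
      (g : Matrix (Fin N) (Fin N) ℂ) * m * ((g⁻¹ : GL (Fin N) ℂ) : Matrix (Fin N) (Fin N) ℂ) - μ • (1 : Matrix (Fin N) (Fin N) ℂ) := by
  rw [Matrix.mul_sub, Matrix.sub_mul, Matrix.mul_smul, Matrix.smul_mul, Matrix.mul_one, Units.mul_inv]

/-- **Conjugation-equivariance of the Lagrange product**: `g · ∏ⱼ (m − μⱼ·1) · g⁻¹ = ∏ⱼ (g m g⁻¹ − μⱼ·1)` (★ `list_prod_map_units_conj` and the factorwise identity).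
[cite: HornJohnson2013, §1.3 (Obs. 1.3.1); Thm. 1.3.9] -/
theorem units_conj_list_prod_sub_smul_one (g : GL (Fin N) ℂ) {ι : Type*} (l : List ι) (μ : ι → ℂ) (m : Matrix (Fin N) (Fin N) ℂ) :
    (g : Matrix (Fin N) (Fin N) ℂ) * (l.map fun j => m - μ j • (1 : Matrix (Fin N) (Fin N) ℂ)).prod * ((g⁻¹ : GL (Fin N) ℂ) : Matrix (Fin N) (Fin N) ℂ) =
      (l.map fun j => (g : Matrix (Fin N) (Fin N) ℂ) * m * ((g⁻¹ : GL (Fin N) ℂ) : Matrix (Fin N) (Fin N) ℂ) - μ j • (1 : Matrix (Fin N) (Fin N) ℂ)).prod := by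
  rw [← list_prod_map_units_conj g l (fun j => m - μ j • (1 : Matrix (Fin N) (Fin N) ℂ))]
  congr 1
  refine List.map_congr_left fun j _ => ?_
  exact units_conj_sub_smul_one g m (μ j)

/-- Joint continuity of `(x, m) ↦ ∏ⱼ (m − μⱼ(x)·1)` for continuous `μⱼ` (the joint continuity of `Q_I(x, z)` of ★ `ArchLocalTorusOrbitalCompactWall`).
[cite: HornJohnson2013, Thm. 1.3.9] -/
private theorem continuous_list_prod_sub_smul_one {X : Type*} [TopologicalSpace X] {ι : Type*} (l : List ι) {μ : ι → X → ℂ}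
    (hμ : ∀ j ∈ l, Continuous (μ j)) :
    Continuous fun p : X × Matrix (Fin N) (Fin N) ℂ => (l.map fun j => p.2 - μ j p.1 • (1 : Matrix (Fin N) (Fin N) ℂ)).prod :=
  continuous_list_prod l fun j hj => continuous_snd.sub (((hμ j hj).comp continuous_fst).smul continuous_const)

end Lagrange

/-! ## §2 The value at the chart: `Δ⁻¹ · ∏_{j≠k}(diag d − dⱼ·1) = E_kk = E_{e_k}` -/

section Value

variable {N : ℕ} {J : Matrix (Fin N) (Fin N) ℂ}

/-- Off the line `k` the Lagrange product at `diag d` vanishes: a factor `dᵢ − dᵢ` occurs. [cite: Varadarajan1977, Part II §2] -/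
theorem list_prod_sub_eq_zero_of_ne (d : Fin N → ℂ) (k : Fin N) {i : Fin N} (hi : i ≠ k) :
    (((Finset.univ.erase k).toList).map fun j => d i - d j).prod = 0 :=
  List.prod_eq_zero (List.mem_map.2 ⟨i, Finset.mem_toList.2 (Finset.mem_erase.2 ⟨hi, Finset.mem_univ i⟩), sub_self _⟩)

/-- On the line `k` the Lagrange product at `diag d` is `Δ = ∏_{j≠k}(d_k − dⱼ)`, non-zero when `d_k` is a SIMPLE eigenvalue. [cite: Varadarajan1977, Part II §2] -/
theorem list_prod_sub_ne_zero_of_ne (d : Fin N → ℂ) (k : Fin N) (hne : ∀ j, j ≠ k → d k ≠ d j) :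
    (((Finset.univ.erase k).toList).map fun j => d k - d j).prod ≠ 0 := by
  refine List.prod_ne_zero fun h0 => ?_
  obtain ⟨j, hj, hj0⟩ := List.mem_map.1 h0
  exact hne j (Finset.mem_erase.1 (Finset.mem_toList.1 hj)).1 (sub_eq_zero.1 hj0)

/-- For a form diagonal at the line `k` (`J k j = 0`, `j ≠ k`): `e_kᴴ J = J_kk · e_kᵀ`. [folklore] -/
private theorem star_single_vecMul_eq (k : Fin N) (hJk : ∀ j, j ≠ k → J k j = 0) :
    star (Pi.single k (1 : ℂ)) ᵥ* J = Pi.single k (J k k) := by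
  ext j
  rw [← Pi.single_star, star_one, Matrix.single_one_vecMul, Matrix.row_apply]
  by_cases h : j = k
  · subst h; simp
  · rw [Pi.single_eq_of_ne h, hJk j h]

/-- The `J`-projector onto `ℂ e_k` is `E_kk` when the form is diagonal at the line `k`. [cite: Varadarajan1977, Part II §2] -/
theorem inv_smul_vecMulVec_single_eq (k : Fin N) (hJk : ∀ j, j ≠ k → J k j = 0) (hkk : J k k ≠ 0) :
    (star (Pi.single k (1 : ℂ)) ⬝ᵥ J *ᵥ Pi.single k (1 : ℂ))⁻¹ • vecMulVec (Pi.single k (1 : ℂ)) (star (Pi.single k (1 : ℂ)) ᵥ* J) =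
      Matrix.single k k (1 : ℂ) := by
  rw [Literature.LinearAlgebra.Matrix.SesquilinearFormDeterminesMatrix.star_single_dotProduct_mulVec_single J k k, star_single_vecMul_eq k hJk]
  ext i j
  rw [Matrix.smul_apply, vecMulVec_apply, Pi.single_apply, Pi.single_apply, Matrix.single_apply, smul_eq_mul]
  by_cases hi : i = k
  · by_cases hj : j = k
    · subst hi; subst hj
      rw [if_pos rfl, if_pos rfl, one_mul, inv_mul_cancel₀ hkk, if_pos ⟨rfl, rfl⟩]
    · rw [if_neg hj, mul_zero, mul_zero, if_neg (fun h => hj h.2.symm)]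
  · rw [if_neg hi, zero_mul, mul_zero, if_neg (fun h => hi h.1.symm)]

/-- **The value of the marker at the chart**: `Δ⁻¹ · ∏_{j≠k} (diag d − dⱼ·1) = E_kk`. [cite: Varadarajan1977, Part II §2] [cite: Knapp1986, Ch. V §3] -/
theorem inv_smul_list_prod_diagonal_eq_single (d : Fin N → ℂ) (k : Fin N) (hne : ∀ j, j ≠ k → d k ≠ d j) :
    ((((Finset.univ.erase k).toList).map fun j => d k - d j).prod)⁻¹ •
        (((Finset.univ.erase k).toList).map fun j => diagonal d - d j • (1 : Matrix (Fin N) (Fin N) ℂ)).prod = Matrix.single k k (1 : ℂ) := by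
  rw [list_prod_map_diagonal_sub_smul_one]
  ext i j
  rw [Matrix.smul_apply, smul_eq_mul, Matrix.single_apply]
  by_cases hij : i = j
  · subst hij
    rw [diagonal_apply_eq]
    by_cases hik : i = k
    · subst hik
      rw [inv_mul_cancel₀ (list_prod_sub_ne_zero_of_ne d i hne), if_pos ⟨rfl, rfl⟩]
    · rw [list_prod_sub_eq_zero_of_ne d k hik, mul_zero, if_neg (fun h => hik h.1.symm)]
  · rw [diagonal_apply_ne _ hij, mul_zero, if_neg (fun h => hij (h.1.symm.trans h.2))]

end Value

/-! ## §3 The compactness lemma for diagonal charts, and `Stab(e_k) ≤ Z(s)` at the semi-regular diagonal points -/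

section DiagonalChart

variable {N : ℕ} {J : Matrix (Fin N) (Fin N) ℂ}

/-- **HARISH-CHANDRA'S COMPACTNESS LEMMA FOR A DIAGONAL CHART.**  `J` hermitian with a right inverse and diagonal at the line `k` (`J k j = 0` for `j ≠ k`, `J k k ≠ 0`);
`c : X → U(J)(ℂ)` a chart of DIAGONAL elements `c(x) = diag(d(x))` with continuous entries; `S ⊆ X` a set on which the eigenvalue `d(x)_k` is SIMPLE (`d(x)_k ≠ d(x)_j`, `j ≠ k`;
the other entries may coincide).  Then for every `M ≥ Stab(e_k)` the chart is UNIFORMLY PROPER MODULO `M` on `S`, in the (HYP) currency of ★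
`continuousOn_integral_descConj_of_uniformlyProper`.  (★ `uniformlyProper_of_marker` with the Lagrange marker `Δ(x)⁻¹ · ∏_{j≠k}(m − d(x)_j·1)`, §1–§2.)  For `G′_w = U(2,1)` in the
house frame, `k` = the even line off the hyperbolic plane and `S` a neighbourhood of the Cayley wall `θ₀ = θ₂` (★ `gprimeTorus_of_wall`): this is the topological input of the
descent `Φ^{G′}(t, ψ) = Φ^{Z(s)}(t, ψ_{Z(s)})` near the wall. [cite: Rogawski1990, §4.12 Lemma 4.12.1 p. 66] [cite: HarishChandra1970, Part I §3 Lemma 22] [cite: Varadarajan1977, Part II §2] [cite: Rogawski1990, §8.2 p. 114] -/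
theorem uniformlyProper_diagonal_of_ne (hJ : J.IsHermitian) {J' : Matrix (Fin N) (Fin N) ℂ} (hJJ' : J * J' = 1) (k : Fin N)
    (hJk : ∀ j, j ≠ k → J k j = 0) (hkk : J k k ≠ 0)
    (M : Subgroup ↥(unitaryGroupOfForm (starRingEnd ℂ) J)) (hM : stabilizer ↥(unitaryGroupOfForm (starRingEnd ℂ) J) (Pi.single k (1 : ℂ) : Fin N → ℂ) ≤ M)
    {X : Type*} [TopologicalSpace X] (c : X → ↥(unitaryGroupOfForm (starRingEnd ℂ) J)) (d : X → Fin N → ℂ) (hd : ∀ i, Continuous fun x => d x i)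
    (hc : ∀ x, ((c x : GL (Fin N) ℂ) : Matrix (Fin N) (Fin N) ℂ) = diagonal (d x))
    {S : Set X} (hne : ∀ x ∈ S, ∀ j, j ≠ k → d x k ≠ d x j) :
    ∀ K ⊆ S, IsCompact K → ∀ C : Set ↥(unitaryGroupOfForm (starRingEnd ℂ) J), IsCompact C →
      ∃ 𝒦 : Set (↥(unitaryGroupOfForm (starRingEnd ℂ) J) ⧸ M), IsCompact 𝒦 ∧
        ∀ x ∈ K, ∀ y : ↥(unitaryGroupOfForm (starRingEnd ℂ) J), y * c x * y⁻¹ ∈ C → (QuotientGroup.mk y : ↥(unitaryGroupOfForm (starRingEnd ℂ) J) ⧸ M) ∈ 𝒦 := by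
  have he : star (Pi.single k (1 : ℂ)) ⬝ᵥ J *ᵥ Pi.single k (1 : ℂ) ≠ 0 := by
    rw [Literature.LinearAlgebra.Matrix.SesquilinearFormDeterminesMatrix.star_single_dotProduct_mulVec_single J k k]; exact hkk
  refine uniformlyProper_of_marker hJ hJJ' he M hM c
    (fun x m => ((((Finset.univ.erase k).toList).map fun j => d x k - d x j).prod)⁻¹ •
      (((Finset.univ.erase k).toList).map fun j => m - d x j • (1 : Matrix (Fin N) (Fin N) ℂ)).prod) ?_ ?_ ?_
  · -- joint continuity on `S × M_n(ℂ)`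
    have hΔ : Continuous fun p : X × Matrix (Fin N) (Fin N) ℂ => (((Finset.univ.erase k).toList).map fun j => d p.1 k - d p.1 j).prod :=
      continuous_list_prod _ fun j _ => ((hd k).sub (hd j)).comp continuous_fst
    have hP := continuous_list_prod_sub_smul_one (N := N) ((Finset.univ.erase k).toList) (μ := fun j x => d x j) (fun j _ => hd j)
    refine ContinuousOn.smul (hΔ.continuousOn.inv₀ ?_) hP.continuousOn
    rintro ⟨x, m⟩ ⟨hx, -⟩
    exact list_prod_sub_ne_zero_of_ne (d x) k (hne x hx)
  · -- conjugation-equivariance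
    intro x _ g m
    rw [Matrix.mul_smul, Matrix.smul_mul, units_conj_list_prod_sub_smul_one]
  · -- value at the chart point
    intro x hx
    rw [hc x, inv_smul_list_prod_diagonal_eq_single (d x) k (hne x hx), inv_smul_vecMulVec_single_eq k hJk hkk]

/-- **Group-level form** (the uniform `hCM` binder of ★ `orbitalIntegral_eq_orbitalIntegral_descended`): one compact `C′ ⊆ U(J)(ℂ)` with `y ∈ C′·M` whenever
`y·diag(d(x))·y⁻¹ ∈ C` for some `x ∈ K`. [cite: Rogawski1990, §4.12 Lemma 4.12.1 p. 66] [cite: HarishChandra1970, Part I §3 Lemma 22] [cite: Rogawski1990, §8.2 p. 114] -/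
theorem exists_isCompact_mul_diagonal_of_ne (hJ : J.IsHermitian) {J' : Matrix (Fin N) (Fin N) ℂ} (hJJ' : J * J' = 1) (k : Fin N)
    (hJk : ∀ j, j ≠ k → J k j = 0) (hkk : J k k ≠ 0)
    (M : Subgroup ↥(unitaryGroupOfForm (starRingEnd ℂ) J)) (hM : stabilizer ↥(unitaryGroupOfForm (starRingEnd ℂ) J) (Pi.single k (1 : ℂ) : Fin N → ℂ) ≤ M)
    {X : Type*} [TopologicalSpace X] (c : X → ↥(unitaryGroupOfForm (starRingEnd ℂ) J)) (d : X → Fin N → ℂ) (hd : ∀ i, Continuous fun x => d x i)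
    (hc : ∀ x, ((c x : GL (Fin N) ℂ) : Matrix (Fin N) (Fin N) ℂ) = diagonal (d x))
    {S : Set X} (hne : ∀ x ∈ S, ∀ j, j ≠ k → d x k ≠ d x j)
    {K : Set X} (hKS : K ⊆ S) (hK : IsCompact K) {C : Set ↥(unitaryGroupOfForm (starRingEnd ℂ) J)} (hC : IsCompact C) :
    ∃ C' : Set ↥(unitaryGroupOfForm (starRingEnd ℂ) J), IsCompact C' ∧
      ∀ x ∈ K, ∀ y : ↥(unitaryGroupOfForm (starRingEnd ℂ) J), y * c x * y⁻¹ ∈ C → y ∈ C' * (M : Set ↥(unitaryGroupOfForm (starRingEnd ℂ) J)) := by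
  obtain ⟨𝒦, h𝒦, hmem⟩ := uniformlyProper_diagonal_of_ne hJ hJJ' k hJk hkk M hM c d hd hc hne K hKS hK C hC
  haveI : LocallyCompactSpace ↥(unitaryGroupOfForm (starRingEnd ℂ) J) := locallyCompactSpace_unitaryGroupOfForm_complex J
  obtain ⟨C', hC', hsub⟩ := Literature.MeasureTheory.Group.exists_isCompact_image_mk_superset M h𝒦
  refine ⟨C', hC', fun x hx y hy => ?_⟩
  obtain ⟨a, ha, hay⟩ := hsub (hmem x hx y hy)
  rw [QuotientGroup.eq] at hay
  exact ⟨a, ha, a⁻¹ * y, hay, by group⟩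

/-- **`Stab(e_k) ≤ Z(s)` for a diagonal `s` that is SCALAR off the line `k`** (`s = diag(v)`, `v j = ζ` for `j ≠ k`: the semi-regular points of the diagonal Cartan, e.g. the
Cayley wall of `U(2,1)`), so that `M := Z(s)` is admissible in `uniformlyProper_diagonal_of_ne`. [cite: Rogawski1990, §4.12 p. 66] [cite: Varadarajan1977, Part II §2] -/
theorem stabilizer_single_le_centralizer_of_diagonal (k : Fin N) (hJk : ∀ j, j ≠ k → J k j = 0) (hkk : J k k ≠ 0)
    (s : ↥(unitaryGroupOfForm (starRingEnd ℂ) J)) {v : Fin N → ℂ} (hs : ((s : GL (Fin N) ℂ) : Matrix (Fin N) (Fin N) ℂ) = diagonal v) {ζ : ℂ} (hv : ∀ j, j ≠ k → v j = ζ) :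
    stabilizer ↥(unitaryGroupOfForm (starRingEnd ℂ) J) (Pi.single k (1 : ℂ) : Fin N → ℂ) ≤
      Subgroup.centralizer ({s} : Set ↥(unitaryGroupOfForm (starRingEnd ℂ) J)) := by
  refine stabilizer_le_centralizer_of_coe_eq s (a := ζ) (b := (v k - ζ) * (J k k)⁻¹) ?_
  rw [hs, star_single_vecMul_eq k hJk]
  ext i j
  simp only [Matrix.add_apply, Matrix.smul_apply, vecMulVec_apply, Pi.single_apply, Matrix.one_apply, diagonal_apply, smul_eq_mul]
  by_cases hij : i = j
  · subst hij
    by_cases hik : i = k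
    · subst hik
      simp only [if_true, mul_one, one_mul]
      rw [mul_assoc, inv_mul_cancel₀ hkk, mul_one, add_sub_cancel]
    · simp only [if_true, if_neg hik, hv i hik, mul_zero, add_zero, mul_one]
  · by_cases hik : i = k
    · subst hik
      simp only [if_neg hij, if_true, if_neg (Ne.symm hij), mul_zero, zero_add]
    · simp only [if_neg hij, if_neg hik, zero_mul, mul_zero, zero_add]

end DiagonalChart


/-! ## §4 (ED. 2) FRAMED diagonal charts `c(x) = P · diag(d(x)) · P⁻¹` with a frame fixing `E_kk` — the SPLIT chart of `U(2,1)` at its real wall `x = 0`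

At a split place the atlas chart is the boost `cayB · diag(e^{x+iθ}, e^{iφ}, e^{−x+iθ}) · cayB⁻¹` (★ `boostStd_eq_conj_diagonal`), whose frame `cayB` is block-diagonal for
`{1} ∪ {0,2}` and therefore FIXES `E₁₁`; at the Cayley point `x = 0` the lines `0, 2` collide and the line `1` stays simple — the same marker works. -/

section Framed

variable {N : ℕ} {J : Matrix (Fin N) (Fin N) ℂ}

/-- **HARISH-CHANDRA'S COMPACTNESS LEMMA FOR A FRAMED DIAGONAL CHART** `c(x) = P · diag(d(x)) · P⁻¹` whose (fixed) frame `P ∈ GL_N(ℂ)` fixes the matrix unit `E_kk`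
(`P E_kk P⁻¹ = E_kk`: `P` preserves the line `k` and the span of the other coordinate lines — the boost frame ★ `cayB` at `k = 1`), for a form diagonal at the line `k`: uniform
properness modulo any `M ≥ Stab(e_k)` on the set where `d(x)_k` is SIMPLE.  (★ `uniformlyProper_of_marker` with the Lagrange marker; at the chart
`Δ⁻¹·∏(P diag P⁻¹ − dⱼ) = P·(Δ⁻¹·∏(diag − dⱼ))·P⁻¹ = P E_kk P⁻¹ = E_kk`.) [cite: Rogawski1990, §4.12 Lemma 4.12.1 p. 66; §8.2 pp. 122–123] [cite: HarishChandra1970, Part I §3 Lemma 22]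
[cite: Knapp1986, Ch. V §3] -/
theorem uniformlyProper_framedDiagonal_of_ne (hJ : J.IsHermitian) {J' : Matrix (Fin N) (Fin N) ℂ} (hJJ' : J * J' = 1) (k : Fin N)
    (hJk : ∀ j, j ≠ k → J k j = 0) (hkk : J k k ≠ 0)
    (M : Subgroup ↥(unitaryGroupOfForm (starRingEnd ℂ) J)) (hM : stabilizer ↥(unitaryGroupOfForm (starRingEnd ℂ) J) (Pi.single k (1 : ℂ) : Fin N → ℂ) ≤ M)
    {X : Type*} [TopologicalSpace X] (c : X → ↥(unitaryGroupOfForm (starRingEnd ℂ) J)) (P : GL (Fin N) ℂ)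
    (hP : (P : Matrix (Fin N) (Fin N) ℂ) * Matrix.single k k (1 : ℂ) * ((P⁻¹ : GL (Fin N) ℂ) : Matrix (Fin N) (Fin N) ℂ) = Matrix.single k k (1 : ℂ))
    (d : X → Fin N → ℂ) (hd : ∀ i, Continuous fun x => d x i)
    (hc : ∀ x, ((c x : GL (Fin N) ℂ) : Matrix (Fin N) (Fin N) ℂ) = (P : Matrix (Fin N) (Fin N) ℂ) * diagonal (d x) * ((P⁻¹ : GL (Fin N) ℂ) : Matrix (Fin N) (Fin N) ℂ))
    {S : Set X} (hne : ∀ x ∈ S, ∀ j, j ≠ k → d x k ≠ d x j) :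
    ∀ K ⊆ S, IsCompact K → ∀ C : Set ↥(unitaryGroupOfForm (starRingEnd ℂ) J), IsCompact C →
      ∃ 𝒦 : Set (↥(unitaryGroupOfForm (starRingEnd ℂ) J) ⧸ M), IsCompact 𝒦 ∧
        ∀ x ∈ K, ∀ y : ↥(unitaryGroupOfForm (starRingEnd ℂ) J), y * c x * y⁻¹ ∈ C → (QuotientGroup.mk y : ↥(unitaryGroupOfForm (starRingEnd ℂ) J) ⧸ M) ∈ 𝒦 := by
  have he : star (Pi.single k (1 : ℂ)) ⬝ᵥ J *ᵥ Pi.single k (1 : ℂ) ≠ 0 := by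
    rw [Literature.LinearAlgebra.Matrix.SesquilinearFormDeterminesMatrix.star_single_dotProduct_mulVec_single J k k]; exact hkk
  refine uniformlyProper_of_marker hJ hJJ' he M hM c
    (fun x m => ((((Finset.univ.erase k).toList).map fun j => d x k - d x j).prod)⁻¹ •
      (((Finset.univ.erase k).toList).map fun j => m - d x j • (1 : Matrix (Fin N) (Fin N) ℂ)).prod) ?_ ?_ ?_
  · have hΔ : Continuous fun p : X × Matrix (Fin N) (Fin N) ℂ => (((Finset.univ.erase k).toList).map fun j => d p.1 k - d p.1 j).prod :=
      continuous_list_prod _ fun j _ => ((hd k).sub (hd j)).comp continuous_fst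
    have hP' := continuous_list_prod_sub_smul_one (N := N) ((Finset.univ.erase k).toList) (μ := fun j x => d x j) (fun j _ => hd j)
    refine ContinuousOn.smul (hΔ.continuousOn.inv₀ ?_) hP'.continuousOn
    rintro ⟨x, m⟩ ⟨hx, -⟩
    exact list_prod_sub_ne_zero_of_ne (d x) k (hne x hx)
  · intro x _ g m
    rw [Matrix.mul_smul, Matrix.smul_mul, units_conj_list_prod_sub_smul_one]
  · intro x hx
    rw [hc x, ← units_conj_list_prod_sub_smul_one P, ← Matrix.smul_mul, ← Matrix.mul_smul,
      inv_smul_list_prod_diagonal_eq_single (d x) k (hne x hx), hP, inv_smul_vecMulVec_single_eq k hJk hkk]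

/-- **Group-level form** for a framed diagonal chart (the uniform `hCM` binder of the descent identity). [cite: Rogawski1990, §4.12 Lemma 4.12.1 p. 66; §8.2 p. 114] -/
theorem exists_isCompact_mul_framedDiagonal_of_ne (hJ : J.IsHermitian) {J' : Matrix (Fin N) (Fin N) ℂ} (hJJ' : J * J' = 1) (k : Fin N)
    (hJk : ∀ j, j ≠ k → J k j = 0) (hkk : J k k ≠ 0)
    (M : Subgroup ↥(unitaryGroupOfForm (starRingEnd ℂ) J)) (hM : stabilizer ↥(unitaryGroupOfForm (starRingEnd ℂ) J) (Pi.single k (1 : ℂ) : Fin N → ℂ) ≤ M)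
    {X : Type*} [TopologicalSpace X] (c : X → ↥(unitaryGroupOfForm (starRingEnd ℂ) J)) (P : GL (Fin N) ℂ)
    (hP : (P : Matrix (Fin N) (Fin N) ℂ) * Matrix.single k k (1 : ℂ) * ((P⁻¹ : GL (Fin N) ℂ) : Matrix (Fin N) (Fin N) ℂ) = Matrix.single k k (1 : ℂ))
    (d : X → Fin N → ℂ) (hd : ∀ i, Continuous fun x => d x i)
    (hc : ∀ x, ((c x : GL (Fin N) ℂ) : Matrix (Fin N) (Fin N) ℂ) = (P : Matrix (Fin N) (Fin N) ℂ) * diagonal (d x) * ((P⁻¹ : GL (Fin N) ℂ) : Matrix (Fin N) (Fin N) ℂ))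
    {S : Set X} (hne : ∀ x ∈ S, ∀ j, j ≠ k → d x k ≠ d x j)
    {K : Set X} (hKS : K ⊆ S) (hK : IsCompact K) {C : Set ↥(unitaryGroupOfForm (starRingEnd ℂ) J)} (hC : IsCompact C) :
    ∃ C' : Set ↥(unitaryGroupOfForm (starRingEnd ℂ) J), IsCompact C' ∧
      ∀ x ∈ K, ∀ y : ↥(unitaryGroupOfForm (starRingEnd ℂ) J), y * c x * y⁻¹ ∈ C → y ∈ C' * (M : Set ↥(unitaryGroupOfForm (starRingEnd ℂ) J)) := by
  obtain ⟨𝒦, h𝒦, hmem⟩ := uniformlyProper_framedDiagonal_of_ne hJ hJJ' k hJk hkk M hM c P hP d hd hc hne K hKS hK C hC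
  haveI : LocallyCompactSpace ↥(unitaryGroupOfForm (starRingEnd ℂ) J) := locallyCompactSpace_unitaryGroupOfForm_complex J
  obtain ⟨C', hC', hsub⟩ := Literature.MeasureTheory.Group.exists_isCompact_image_mk_superset M h𝒦
  refine ⟨C', hC', fun x hx y hy => ?_⟩
  obtain ⟨a, ha, hay⟩ := hsub (hmem x hx y hy)
  rw [QuotientGroup.eq] at hay
  exact ⟨a, ha, a⁻¹ * y, hay, by group⟩

/-- **At a semi-regular parameter the framed element IS diagonal**: if `P E_kk P⁻¹ = E_kk` and `v` is constant `= ζ` off the line `k`, then `P · diag v · P⁻¹ = diag v`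
(`diag v = ζ·1 + (v_k − ζ)·E_kk`) — so ★ `stabilizer_single_le_centralizer_of_diagonal` applies to the framed chart point. [cite: Knapp1986, Ch. V §3] -/
theorem framed_diagonal_eq_of_const_off (k : Fin N) (P : GL (Fin N) ℂ)
    (hP : (P : Matrix (Fin N) (Fin N) ℂ) * Matrix.single k k (1 : ℂ) * ((P⁻¹ : GL (Fin N) ℂ) : Matrix (Fin N) (Fin N) ℂ) = Matrix.single k k (1 : ℂ))
    {v : Fin N → ℂ} {ζ : ℂ} (hv : ∀ j, j ≠ k → v j = ζ) :
    (P : Matrix (Fin N) (Fin N) ℂ) * diagonal v * ((P⁻¹ : GL (Fin N) ℂ) : Matrix (Fin N) (Fin N) ℂ) = diagonal v := by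
  have hdiag : diagonal v = ζ • (1 : Matrix (Fin N) (Fin N) ℂ) + (v k - ζ) • Matrix.single k k (1 : ℂ) := by
    ext i j
    rw [Matrix.add_apply, Matrix.smul_apply, Matrix.smul_apply, Matrix.one_apply, diagonal_apply, Matrix.single_apply, smul_eq_mul, smul_eq_mul]
    by_cases hij : i = j
    · subst hij
      by_cases hik : i = k
      · subst hik; simp
      · rw [if_pos rfl, if_pos rfl, if_neg (fun h => hik h.1.symm), hv i hik, mul_one, mul_zero, add_zero]
    · rw [if_neg hij, if_neg hij, if_neg (fun h => hij (h.1.symm.trans h.2)), mul_zero, mul_zero, add_zero]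
  rw [hdiag, Matrix.mul_add, Matrix.add_mul, Matrix.mul_smul, Matrix.smul_mul, Matrix.mul_one, Units.mul_inv, Matrix.mul_smul, Matrix.smul_mul, hP]

end Framed

end Literature.NumberTheory.Automorphic.UnitaryGroup
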